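import Mathlib
import HarnessLib
import Summits.NavierStokesRegularity.NavierStokesRegularity.Theorems.PoloidalWindowDoorLrcModEntireAxisKinematics10
import Summits.NavierStokesRegularity.NavierStokesRegularity.Theorems.PoloidalWindowDoorLrcModEntireAxisKinematics11
import Summits.NavierStokesRegularity.NavierStokesRegularity.Theorems.PoloidalWindowDoorLrcModEntireAxisKinematics12

/-!
# Route `PoloidalWindowDoor`, item `LrcModEntire` (stmt-NavierStokesRegularity-20428) — AXIS KINEMATICS XIII: THE AXIS THEOREM
# «in the class, a vertical velocity that is rotation-invariant per height about a moving vertical axis has a STATIC axis»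

Cell ns-regularity-ideate, seat ns-poloidal-K2-p3 gen 5 (LEAD of item 20428; file landed `--supports stmt-NavierStokesRegularity-20428` as a
helper).  Assembly step VIII of AXIS-NOTE (the kinematic «common axis» lemma of the thick-stratum endgame).  For a profile `v` of the
route's Type-I class, a slice `s < 0`, a `C³` centre curve `z ↦ (c₀(z), c₁(z))` and an open `O ⊆ ℝ³` on which, with `V = v₂(s,·)` and
`L = (y₀ − c₀(y₂))∂₁ − (y₁ − c₁(y₂))∂₀` (the rotation generator about the vertical axis through `(c₀(y₂), c₁(y₂))`):
(R) `L V = 0`, (S) `L(∂₂²V) = 0`, and (ND) `∇_h V ≠ 0` — THEN `c′(y₂) = 0` for every `y ∈ O`: the axis does not move with the height.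

Proof (X + XI + XII + V-plane): at an off-axis point of `O` at the given height, X gives the local dichotomy `P_rr · U_wU_{c′} = 0` on the
plane; if `c′ ≠ 0`, XI forces `P_rr = 0` along the plane, XII integrates it to `V = kρ² + m` on a planar open piece, and the class
(analyticity + Type-I bound, XI/V-plane) forces `k = 0` and a horizontally flat plane, contradicting (ND).

* `exists_offAxis` — an open set meeting a height contains an off-axis point at that height.
* `deriv_centre_eq_zero` — the theorem above.

WHAT THIS IS NOT: not a claim about Navier–Stokes regularity and not the crux `LrcModEntire`: it is the kinematic half of the
thick-stratum endgame (the structural input «ND poloidal class jets are per-plane isoparametric» (ISO) remains OPEN; see the census of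
item 20428) — bears_on LADDER-NS N0 via item 20428.
-/

noncomputable section

-- the summit and its single sub-problem share the name (CONVENTIONS §1), as in every Theorems file
set_option linter.dupNamespace false

namespace Summit.NavierStokesRegularity.NavierStokesRegularity.Theorems.PoloidalWindowDoorLrcModEntireAxisKinematics13

open Set Function Filter Topology Metric
open scoped RealInnerProductSpace InnerProductSpace
open Literature.Analysis Literature.Analysis.FluidPDE
open Summit.NavierStokesRegularity.NavierStokesRegularity.Theorems.LocalSineTubeDoorProfileAlignedWindowRigidityAncient
open Summit.NavierStokesRegularity.NavierStokesRegularity.Theorems.PoloidalWindowDoorLrcModEntireAxisKinematics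
open Summit.NavierStokesRegularity.NavierStokesRegularity.Theorems.PoloidalWindowDoorLrcModEntireAxisKinematics10
open Summit.NavierStokesRegularity.NavierStokesRegularity.Theorems.PoloidalWindowDoorLrcModEntireAxisKinematics11
open Summit.NavierStokesRegularity.NavierStokesRegularity.Theorems.PoloidalWindowDoorLrcModEntireAxisKinematics12

/-- An open set containing a point `x` contains a point at the height `x₂` OFF the vertical axis through `(c₀(x₂), c₁(x₂))`. -/
theorem exists_offAxis {O : Set (EuclideanSpace ℝ (Fin 3))} (hO : IsOpen O) {x : EuclideanSpace ℝ (Fin 3)} (hx : x ∈ O)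
    (c₀ c₁ : ℝ → ℝ) : ∃ ys ∈ O, ys 2 = x 2 ∧ (ys 0 ≠ c₀ (ys 2) ∨ ys 1 ≠ c₁ (ys 2)) := by
  by_cases h : x 0 ≠ c₀ (x 2) ∨ x 1 ≠ c₁ (x 2)
  · exact ⟨x, hx, rfl, h⟩
  · push Not at h
    obtain ⟨ε, hε, hball⟩ := Metric.isOpen_iff.1 hO x hx
    refine ⟨x + (ε / 2) • EuclideanSpace.single 0 (1 : ℝ), hball ?_, by simp, ?_⟩
    · rw [mem_ball, dist_eq_norm, add_sub_cancel_left, norm_smul, PiLp.norm_single, norm_one, mul_one,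
        Real.norm_eq_abs, abs_of_pos (by positivity)]
      linarith
    · left
      simp only [PiLp.add_apply, PiLp.smul_apply, PiLp.single_apply, smul_eq_mul]
      simp only [if_true, mul_one, show ((2 : Fin 3) = 0) = False by decide, if_false, mul_zero, add_zero]
      rw [← h.1]
      linarith

section Class

variable {C : ℝ} {v : ℝ → EuclideanSpace ℝ (Fin 3) → EuclideanSpace ℝ (Fin 3)}

/-- **THE AXIS THEOREM (class form).**  See the module docstring: (R) + (S) + (ND) on an open `O` for `V = v₂(s,·)`, `s < 0`, `v` in the
route's Type-I class, `c₀ c₁ ∈ C³` ⇒ `c₀′(y₂) = c₁′(y₂) = 0` for every `y ∈ O`. -/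
theorem deriv_centre_eq_zero (hrate : HasTypeITimeDecay C v)
    (hcont : ContinuousOn (uncurry v) (Iio (0 : ℝ) ×ˢ univ))
    (hmild : ∀ s t : ℝ, s < t → t < 0 → ∀ x,
      v t x = UnboundedOperators.heatExtension (v s) (t - s) x - oseenDuhamel 1 s v v t x)
    {s : ℝ} (hs : s < 0) {c₀ c₁ : ℝ → ℝ} (hc₀ : ContDiff ℝ 3 c₀) (hc₁ : ContDiff ℝ 3 c₁)
    {O : Set (EuclideanSpace ℝ (Fin 3))} (hO : IsOpen O)
    (hR : ∀ y ∈ O, (y 0 - c₀ (y 2)) * fderiv ℝ (fun y' => v s y' 2) y (EuclideanSpace.single 1 1) -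
      (y 1 - c₁ (y 2)) * fderiv ℝ (fun y' => v s y' 2) y (EuclideanSpace.single 0 1) = 0)
    (hS : ∀ y ∈ O, (y 0 - c₀ (y 2)) *
          fderiv ℝ (fun y' => fderiv ℝ (fun y'' => fderiv ℝ (fun x => v s x 2) y'' (EuclideanSpace.single 2 1)) y'
            (EuclideanSpace.single 2 1)) y (EuclideanSpace.single 1 1) -
        (y 1 - c₁ (y 2)) *
          fderiv ℝ (fun y' => fderiv ℝ (fun y'' => fderiv ℝ (fun x => v s x 2) y'' (EuclideanSpace.single 2 1)) y'
            (EuclideanSpace.single 2 1)) y (EuclideanSpace.single 0 1) = 0)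
    (hND : ∀ y ∈ O, fderiv ℝ (v s) y (EuclideanSpace.single 0 1) 2 ≠ 0 ∨ fderiv ℝ (v s) y (EuclideanSpace.single 1 1) 2 ≠ 0)
    {x : EuclideanSpace ℝ (Fin 3)} (hx : x ∈ O) : deriv c₀ (x 2) = 0 ∧ deriv c₁ (x 2) = 0 := by
  -- the vertical velocity as a `C³` function
  set V : EuclideanSpace ℝ (Fin 3) → ℝ := fun y => v s y 2 with hVdef
  have hA : AnalyticOnNhd ℝ (v s) univ := analyticOnNhd_slice hcont (bdd_of_hasTypeITimeDecay hrate) hmild hs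
  have hV : ContDiff ℝ 3 V :=
    (EuclideanSpace.proj (2 : Fin 3) : EuclideanSpace ℝ (Fin 3) →L[ℝ] ℝ).contDiff.comp hA.contDiff
  have hc₀d : Differentiable ℝ c₀ := hc₀.differentiable (by norm_num)
  have hc₁d : Differentiable ℝ c₁ := hc₁.differentiable (by norm_num)
  -- an off-axis point of `O` at the same height
  obtain ⟨ys, hys, hysz, hoff⟩ := exists_offAxis hO hx c₀ c₁
  rw [← hysz]
  -- X: the local dichotomy at `ys`
  obtain ⟨P, hP3, hPeq, hdich⟩ := axis_dichotomy_local hV hc₀ hc₁ hO hR hS hys hoff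
  set z₀ : ℝ := ys 2 with hz₀
  set cc : EuclideanSpace ℝ (Fin 3) := WithLp.toLp 2 ![c₀ z₀, c₁ z₀, 0] with hcc
  set a : EuclideanSpace ℝ (Fin 3) := WithLp.toLp 2 ![deriv c₀ z₀, deriv c₁ z₀, 0] with ha
  have hcc0 : cc 0 = c₀ z₀ := rfl
  have hcc1 : cc 1 = c₁ z₀ := rfl
  have ha0 : a 0 = deriv c₀ z₀ := rfl
  have ha1 : a 1 = deriv c₁ z₀ := rfl
  by_contra hne
  have ha' : a 0 ≠ 0 ∨ a 1 ≠ 0 := by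
    rw [ha0, ha1]
    by_contra h'
    push Not at h'
    exact hne ⟨h'.1, h'.2⟩
  -- regularity of `P` near `ys` and continuity of `α = P_rr ∘ Ψ`
  have hΨc : Continuous (fun y : EuclideanSpace ℝ (Fin 3) => ((y 0 - c₀ (y 2)) ^ 2 + (y 1 - c₁ (y 2)) ^ 2, y 2)) := by
    have h0 : Continuous (fun y' : EuclideanSpace ℝ (Fin 3) => y' 0) :=
      (EuclideanSpace.proj (0 : Fin 3) : EuclideanSpace ℝ (Fin 3) →L[ℝ] ℝ).continuous
    have h1 : Continuous (fun y' : EuclideanSpace ℝ (Fin 3) => y' 1) :=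
      (EuclideanSpace.proj (1 : Fin 3) : EuclideanSpace ℝ (Fin 3) →L[ℝ] ℝ).continuous
    have h2 : Continuous (fun y' : EuclideanSpace ℝ (Fin 3) => y' 2) :=
      (EuclideanSpace.proj (2 : Fin 3) : EuclideanSpace ℝ (Fin 3) →L[ℝ] ℝ).continuous
    exact (((h0.sub (hc₀d.continuous.comp h2)).pow 2).add ((h1.sub (hc₁d.continuous.comp h2)).pow 2)).prodMk h2
  have hP3n : ∀ᶠ y in 𝓝 ys, ContDiffAt ℝ 3 P ((y 0 - c₀ (y 2)) ^ 2 + (y 1 - c₁ (y 2)) ^ 2, y 2) :=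
    (hΨc.tendsto ys).eventually (hP3.eventually (by simp))
  have hαc : ∀ᶠ y in 𝓝 ys, ContinuousAt
      (fun y' : EuclideanSpace ℝ (Fin 3) =>
        fderiv ℝ (fun q => fderiv ℝ P q (1, 0)) ((y' 0 - c₀ (y' 2)) ^ 2 + (y' 1 - c₁ (y' 2)) ^ 2, y' 2) (1, 0)) y := by
    filter_upwards [hP3n] with y hy
    have hPr2 : ContDiffAt ℝ 2 (fun q => fderiv ℝ P q (1, 0)) ((y 0 - c₀ (y 2)) ^ 2 + (y 1 - c₁ (y 2)) ^ 2, y 2) :=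
      (hy.fderiv_right (m := 2) (by norm_num)).clm_apply contDiffAt_const
    have hPrr1 : ContDiffAt ℝ 1 (fun q => fderiv ℝ (fun q' => fderiv ℝ P q' (1, 0)) q (1, 0))
        ((y 0 - c₀ (y 2)) ^ 2 + (y 1 - c₁ (y 2)) ^ 2, y 2) :=
      (hPr2.fderiv_right (m := 1) (by norm_num)).clm_apply contDiffAt_const
    exact ContinuousAt.comp (x := y) hPrr1.continuousAt hΨc.continuousAt
  -- an open `B ∋ ys` carrying: the dichotomy, the continuity of `α`
  obtain ⟨B, hB, hBo, hysB⟩ := _root_.mem_nhds_iff.1 (hdich.and hαc)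
  -- XI: `α = 0` on `B ∩ {y₂ = z₀}`
  have hα0 : ∀ y ∈ B, y 2 = z₀ →
      fderiv ℝ (fun q => fderiv ℝ P q (1, 0)) ((y 0 - c₀ (y 2)) ^ 2 + (y 1 - c₁ (y 2)) ^ 2, y 2) (1, 0) = 0 := by
    intro y hy hyz
    refine eq_zero_of_mul_hdot_eq_zero_plane
      (α := fun y' : EuclideanSpace ℝ (Fin 3) =>
        fderiv ℝ (fun q => fderiv ℝ P q (1, 0)) ((y' 0 - c₀ (y' 2)) ^ 2 + (y' 1 - c₁ (y' 2)) ^ 2, y' 2) (1, 0))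
      (c := cc) (a := a) hBo (z₀ := z₀) (fun y' hy' _ => (hB hy').2) ha' (fun y' hy' hy'z => ?_) hy hyz
    have := (hB hy').1 hy'z
    rw [hcc0, hcc1, ha0, ha1]
    exact this
  -- XII: `V = k ρ² + m` on the plane near `ys`
  have hP3' : ContDiffAt ℝ 3 P ((ys 0 - cc 0) ^ 2 + (ys 1 - cc 1) ^ 2, z₀) := by
    rw [hcc0, hcc1]
    exact hP3
  have hΨ'c : Continuous (fun y : EuclideanSpace ℝ (Fin 3) => ((y 0 - cc 0) ^ 2 + (y 1 - cc 1) ^ 2, z₀)) :=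
    (contDiff_sqDist cc (n := 0)).continuous.prodMk continuous_const
  have hP2n : ∀ᶠ y in 𝓝 ys, ContDiffAt ℝ 2 P ((y 0 - cc 0) ^ 2 + (y 1 - cc 1) ^ 2, z₀) :=
    ((hΨ'c.tendsto ys).eventually (hP3'.eventually (by simp))).mono fun y hy => hy.of_le (by norm_num)
  have hVn : ∀ᶠ y in 𝓝 ys, y 2 = z₀ → V y = P ((y 0 - cc 0) ^ 2 + (y 1 - cc 1) ^ 2, z₀) := by
    filter_upwards [hPeq] with y hy hyz
    rw [hcc0, hcc1, ← hyz]
    exact hy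
  have hrrn : ∀ᶠ y in 𝓝 ys, y 2 = z₀ →
      fderiv ℝ (fun q => fderiv ℝ P q (1, 0)) ((y 0 - cc 0) ^ 2 + (y 1 - cc 1) ^ 2, z₀) (1, 0) = 0 := by
    filter_upwards [hBo.mem_nhds hysB] with y hy hyz
    have := hα0 y hy hyz
    rw [hcc0, hcc1, ← hyz]
    exact this
  obtain ⟨k, m, hquad⟩ := eq_quadratic_of_rr_eq_zero (V := V) (c := cc) (x := ys) (z₀ := z₀) rfl hP2n hVn hrrn
  -- the class excludes it: the plane is horizontally flat at `ys`, contradicting (ND)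
  obtain ⟨U, hU, hUo, hysU⟩ := _root_.mem_nhds_iff.1 hquad
  have hq : ∀ y ∈ U, y 2 = z₀ → v s y 2 = k * ((y 0 - cc 0) ^ 2 + (y 1 - cc 1) ^ 2) + m := fun y hy hyz => hU hy hyz
  have h0 := horizontalGradient_eq_zero_of_quadratic_plane hrate hcont hmild hs hUo ⟨ys, hysU, rfl⟩ hq (y := ys) rfl
    (b := 0) (by decide)
  have h1 := horizontalGradient_eq_zero_of_quadratic_plane hrate hcont hmild hs hUo ⟨ys, hysU, rfl⟩ hq (y := ys) rfl
    (b := 1) (by decide)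
  rcases hND ys hys with h | h
  · exact h h0
  · exact h h1

end Class

end Summit.NavierStokesRegularity.NavierStokesRegularity.Theorems.PoloidalWindowDoorLrcModEntireAxisKinematics13

end
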